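/-
Copyright (c) 2026 the pub-hodgecm-mathlib formalisation cell (harness21).  Prover seat hodgecm-mathlib-R90-CS-p03 (g2), R90-TF section S8 «ContSpec-n½» (dealer R90-CS-plan (g3),
S8-R155 (2) «(a-8) = YOURS»; census `R90/S8/CENSUS-a8-CTFactorisationContinued.R90-CS-p03-g2.md`; file (a-8)): the payer of the (V)-assembly letter `hfac` — the SCALAR × NORMALISED-SECTION
factorisation `ψ(z, g) = qc(z)·(A_g(z)∕A_1(z))` of the `H^{2−z}`-coefficient of the constant term, CONTINUED from `{2 < Re z}` to the punctured neighbourhood of `z = 3∕2` by the identity theorem.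
-/
import Summits.HodgeConjecture.HodgeConjecture.Theorems.K2E1ConvexDiffCountableConnected   -- ★ `isPreconnected_convex_diff_of_countable`, `countable_of_codiscrete`; brings ★ `one_lt_rank_real_complex`
import Mathlib.Analysis.Complex.Convex
import Mathlib.Analysis.Complex.CauchyIntegral
import Mathlib.Analysis.Analytic.Uniqueness
import HarnessLib

/-!
# K2·E1 ∕ R90·S8 — `K2E1ChiConstantTermFactorisationContinuedU3` (file (a-8)): THE FACTORISATION `ψ(z,g) = qc(z)·(A_g(z)∕A_1(z))` CONTINUED TO THE MIDDLE POINT —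
# ★ (V) assembly p863385's letter `hfac : ∀ᶠ z in 𝓝[≠] (3∕2), ∀ g, ψ z g = qc z * φt z g` at `φt := fun z g => Ag g z ∕ A₁ z` (★ (a-7)'s model), by the identity theorem on the
# PRECONNECTED domain `{1 < Re} ∖ (Sp ∪ P)` (a half-plane minus a countable set)

Cell `pub/hodgecm-mathlib`, crux h413 = `stmt-HodgeConjecture-24833`, route of record `HCCMUnconditional`; R90-TF section S8 «ContSpec-n½», road R2-χ₃ (the (V) scalar road; junction J-S8-SCAL:
the scalar letters `(q qc) {P} (hqcq) (hPcd) (hqa) (hfac) …` are the binder bytes of ★ `R90S8ResGMidBlockNeBotAssemblyU3` :299–:301).  THEOREMS ONLY (no `def`, no `instance`, no notation,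
no named-fact hypothesis, no `sorry`; default heartbeats); lane `--supports stmt-HodgeConjecture-24833 --as helper` (count-neutral).  Closes no socket.  Pure complex analysis ∕ topology
(generic `G`); no automorphic input.

THE MATHEMATICS ([MoeglinWaldspurger1995] IV.1.11; [Langlands1976] Appendix; [Titchmarsh1939] §4.4 (identity theorem)).  On `{2 < Re z}` the unipotent integral of every `g`-translate of the
χ-section unfolds (★ (a-2b)) as `ψ(z,g) = A_g(z)·c^S(z)` with the SAME Euler quotient `c^S` and the scattering scalar is `q(z) = A_1(z)·c^S(z)` (★ F5's `hsrc`); so `F_g(z) :=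
ψ(z,g)·A_1(z) − qc(z)·A_g(z)` (NO division) vanishes on `{2 < Re z}`.  `F_g` is analytic at every point of `V := {1 < Re} ∖ (Sp ∪ P)` (`ψ(·,g)` holomorphic off the finite pole set `Sp` of the
continued family — letter `hψa`; `qc` analytic off `P`; `A_1, A_g` holomorphic on `{1<Re}` ★ (a-3)); `P` has no accumulation point (`hPcd`), hence is COUNTABLE (Lindelöf), so `Sp ∪ P` is
countable (★ `K2E1ConvexDiffCountableConnected.countable_of_codiscrete`) and `V` — an open convex set minus a countable set — is PRECONNECTED (★ `isPreconnected_convex_diff_of_countable`,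
`rank_ℝ ℂ > 1`).  The identity theorem gives `F_g ≡ 0` on `V`; near `3∕2` (punctured) `z ∈ V` and `A_1(z) ≠ 0` (`hA32` + continuity), so `ψ(z,g) = qc(z)·A_g(z)∕A_1(z)`.
* HEAD **`eventually_factorisation_of_unfolded`** — ★ p863385's `hfac` bytes at `φt := fun z g => Ag g z ∕ A₁ z`, from: the J-S8-SCAL scalar letters VERBATIM; `A₁` holomorphic on `{1<Re}`
  with `A₁(3∕2) ≠ 0`; an Euler-quotient factor `cS` with `hq : q = A₁·cS` on `{2<Re}` (★ F5's `hsrc`); translate amplitudes `Ag` holomorphic on `{1<Re}` (★ (a-3)) with the UNFOLDING letter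
  `hψ2 : ψ z g = Ag g z · cS z` on `{2<Re}` (★ (a-2b) for translates); and `hψa : ∀ g, DifferentiableOn ℂ (ψ · g) ({1<Re} ∖ Sp)` (CT-holomorphy of the continued family, exports lineage).
HONEST SCOPE.  NOT here: the letters `hψ2` (section factorisation of the translates + ★ (a-2b)) and `hψa` (= `hE3c` of the exports lineage read through `hE3`); `cS`'s identity with the
`partialStandardL` quotient is by instantiation at the consumer.
HONEST LABEL: HC_CM is proved only modulo the 7 printed citations (2 remaining named inputs: hLiu418 = `stmt-HodgeConjecture-24832`, h413 = `stmt-HodgeConjecture-24833`) until rung 0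
closes; REL ≠ ★ ≠ BUILT; this file asserts no named fact and closes no socket; count-neutral.

## References
* [MoeglinWaldspurger1995] C. Mœglin, J.-L. Waldspurger, *Spectral Decomposition and Eisenstein Series* (1995): IV.1.11.
* [Langlands1976] R. P. Langlands, *On the Functional Equations Satisfied by Eisenstein Series*, LNM 544 (1976): Appendix (rank one).
* [Titchmarsh1939] E. C. Titchmarsh, *The Theory of Functions*, 2nd ed. (1939): §4.4.
-/

set_option autoImplicit false
set_option linter.dupNamespace false -- the mandated namespace repeats `HodgeConjecture.HodgeConjecture`

noncomputable section

open Filter Set Topology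
open Literature.Topology.Euclidean (one_lt_rank_real_complex)
open Summit.HodgeConjecture.HodgeConjecture.Cruxes.H413.K2E1ConvexDiffCountableConnected (isPreconnected_convex_diff_of_countable countable_of_codiscrete)

namespace Summit.HodgeConjecture.HodgeConjecture.Cruxes.H413.K2E1ChiConstantTermFactorisationContinuedU3

/-! ## HEAD: the factorisation continued to the punctured neighbourhood of `3∕2` -/

/-- **★ (V)'s LETTER `hfac` AT `φt := fun z g => Ag g z ∕ A₁ z`.**  Scalar letters `(q qc) {P} (hqcq) (hPcd) (hqa)` as in ★ `R90S8ResGMidBlockNeBotAssemblyU3` :299; `A₁` holomorphic on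
`{1 < Re}` with `A₁ (3∕2) ≠ 0`; `cS` with `q = A₁·cS` on `{2 < Re}` (★ F5's `hsrc`); translate amplitudes `Ag` holomorphic on `{1 < Re}` with the unfolding `ψ z g = Ag g z · cS z` on
`{2 < Re}`; `ψ(·, g)` holomorphic on `{1 < Re} ∖ Sp` (`Sp` finite).  THEN `∀ᶠ z in 𝓝[≠] (3∕2), ∀ g, ψ z g = qc z * (Ag g z ∕ A₁ z)` (identity theorem for `ψ·A₁ − qc·Ag` on the
preconnected `{1<Re} ∖ (Sp ∪ P)` ★). [cite: MoeglinWaldspurger1995, IV.1.11] [cite: Langlands1976, Appendix] [cite: Titchmarsh1939, §4.4] -/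
theorem eventually_factorisation_of_unfolded {G : Type*} (ψ : ℂ → G → ℂ) (q qc : ℂ → ℂ) {P : Set ℂ}
    (hqcq : ∀ z : ℂ, 2 < z.re → qc z = q z) (hPcd : ∀ z₀ : ℂ, ∀ᶠ s in 𝓝[≠] z₀, s ∉ P) (hqa : ∀ z : ℂ, z ∉ P → AnalyticAt ℂ qc z)
    (A₁ : ℂ → ℂ) (hA : DifferentiableOn ℂ A₁ {z : ℂ | 1 < z.re}) (hA32 : A₁ (3 / 2) ≠ 0)
    (cS : ℂ → ℂ) (hq : ∀ z : ℂ, 2 < z.re → q z = A₁ z * cS z)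
    (Ag : G → ℂ → ℂ) (hAg : ∀ g, DifferentiableOn ℂ (Ag g) {z : ℂ | 1 < z.re}) (hψ2 : ∀ z : ℂ, 2 < z.re → ∀ g, ψ z g = Ag g z * cS z)
    (Sp : Finset ℂ) (hψa : ∀ g, DifferentiableOn ℂ (fun z => ψ z g) ({z : ℂ | 1 < z.re} \ (↑Sp : Set ℂ))) :
    ∀ᶠ z in 𝓝[≠] ((3 : ℂ) / 2), ∀ g, ψ z g = qc z * (Ag g z / A₁ z) := by
  set V : Set ℂ := {z : ℂ | 1 < z.re} \ ((↑Sp : Set ℂ) ∪ P) with hV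
  have hCc : ((↑Sp : Set ℂ) ∪ P).Countable := Sp.countable_toSet.union (countable_of_codiscrete hPcd)
  have hopen : IsOpen {z : ℂ | 1 < z.re} := isOpen_lt continuous_const Complex.continuous_re
  have hVpc : IsPreconnected V := isPreconnected_convex_diff_of_countable one_lt_rank_real_complex (convex_halfSpace_re_gt 1) hopen hCc
  have hopen2 : IsOpen {z : ℂ | 2 < z.re} := isOpen_lt continuous_const Complex.continuous_re
  have hopenS : IsOpen ({z : ℂ | 1 < z.re} \ (↑Sp : Set ℂ)) := hopen.sdiff Sp.finite_toSet.isClosed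
  -- a base point `z₁` with `2 < Re z₁` outside `Sp ∪ P`
  obtain ⟨z₁, hz₁C, hz₁⟩ : ∃ z₁, z₁ ∈ ((↑Sp : Set ℂ) ∪ P)ᶜ ∧ z₁ ∈ {z : ℂ | 2 < z.re} :=
    (hCc.dense_compl ℝ).exists_mem_open hopen2 ⟨3, by show (2 : ℝ) < (3 : ℂ).re; norm_num⟩
  have hz₁' : 2 < z₁.re := hz₁
  -- `F_g := ψ·A₁ − qc·Ag` vanishes on `V`
  have hF : ∀ g, EqOn (fun z => ψ z g * A₁ z - qc z * Ag g z) 0 V := fun g => by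
    have han : AnalyticOnNhd ℂ (fun z => ψ z g * A₁ z - qc z * Ag g z) V := by
      intro z hz
      have hz1 : z ∈ {z : ℂ | 1 < z.re} := hz.1
      have hzS : z ∈ {z : ℂ | 1 < z.re} \ (↑Sp : Set ℂ) := ⟨hz.1, fun h => hz.2 (Or.inl h)⟩
      have hzP : z ∉ P := fun h => hz.2 (Or.inr h)
      exact (((hψa g).analyticAt (hopenS.mem_nhds hzS)).mul (hA.analyticAt (hopen.mem_nhds hz1))).sub
        ((hqa z hzP).mul ((hAg g).analyticAt (hopen.mem_nhds hz1)))
    have hz₁V : z₁ ∈ V := ⟨show (1 : ℝ) < z₁.re by linarith, hz₁C⟩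
    have hev : (fun z => ψ z g * A₁ z - qc z * Ag g z) =ᶠ[𝓝 z₁] 0 := by
      filter_upwards [hopen2.mem_nhds hz₁] with z hz
      have hz' : 2 < z.re := hz
      simp only [Pi.zero_apply]
      rw [hψ2 z hz' g, hqcq z hz', hq z hz']
      ring
    exact han.eqOn_zero_of_preconnected_of_eventuallyEq_zero hVpc hz₁V hev
  -- near `3∕2` (punctured): `z ∈ V` and `A₁ z ≠ 0`
  have h32mem : ((3 : ℂ) / 2) ∈ {z : ℂ | 1 < z.re} := by
    show (1 : ℝ) < ((3 : ℂ) / 2).re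
    norm_num
  have hA1 : ∀ᶠ z in 𝓝 ((3 : ℂ) / 2), A₁ z ≠ 0 := (hA.continuousOn.continuousAt (hopen.mem_nhds h32mem)).eventually_ne hA32
  have hSp : ∀ᶠ z in 𝓝[≠] ((3 : ℂ) / 2), z ∉ (↑Sp : Set ℂ) := by
    have hcl : (↑(Sp.erase ((3 : ℂ) / 2)) : Set ℂ)ᶜ ∈ 𝓝 ((3 : ℂ) / 2) :=
      (Sp.erase ((3 : ℂ) / 2)).finite_toSet.isClosed.isOpen_compl.mem_nhds (by simp)
    filter_upwards [mem_nhdsWithin_of_mem_nhds hcl, self_mem_nhdsWithin] with z hz hne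
    intro hzS
    exact hz (Finset.mem_coe.2 (Finset.mem_erase.2 ⟨hne, hzS⟩))
  filter_upwards [mem_nhdsWithin_of_mem_nhds (hopen.mem_nhds h32mem), hSp, hPcd ((3 : ℂ) / 2), mem_nhdsWithin_of_mem_nhds hA1] with z hz1 hzS hzP hzA g
  have hzV : z ∈ V := ⟨hz1, fun h => h.elim hzS hzP⟩
  have h0 := hF g hzV
  simp only [Pi.zero_apply, sub_eq_zero] at h0
  rw [mul_div_assoc', eq_div_iff hzA]
  exact h0

end Summit.HodgeConjecture.HodgeConjecture.Cruxes.H413.K2E1ChiConstantTermFactorisationContinuedU3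

end
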